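import Literature.Geometry.Kaehler.RiemannSurfaceJacobianPolarization
import HarnessLib

/-!
# The loop differentials `η_γ` of a compact Riemann surface and the Riemann form on the period lattice
# (Lange, *Abelian Varieties over the Complex Numbers*, §4.1.2; Forster §21.7)

Layer `Literature/Geometry/Kaehler`, sequel of `RiemannSurfacePeriodPairing` (existence of a
holomorphic `η` with `⟪θ, η⟫ = -(C/2) ∫_γ θ` for all `θ ∈ Ω(M)` and `2 Re ∫_δ η ∈ ℤ`) and
`RiemannSurfaceJacobianPolarization` (the Riesz map `pairingFunctional`, the Riemann form
`jacobianRiemannForm` and `isAbelianVariety_jacobian`).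

The existence statement is made CANONICAL: `⟪·, ·⟫` is non-degenerate (Riemann's inequality), so the
differential of a loop is unique.

* §1 `pairingFunctional` is injective (basis-free Riesz injectivity); **`loopDifferential x₀ γ`**, the
  unique `η_γ ∈ Ω(M)` with `⟪θ, η_γ⟫ = -(C/2) ∫_γ θ` for all `θ` (`holPairing_loopDifferential`,
  `loopDifferential_eq_of_holPairing_eq`); it is a homomorphism in `γ`
  (`loopDifferential_mul/one/inv`, **`loopDifferentialHom : π₁(M, x₀)ᵃᵇ-additive →+ Ω(M)`**), its
  periods satisfy `2 Re ∫_δ η_γ ∈ ℤ` and **Riemann's bilinear relation** `∫_δ η_γ = -conj ∫_γ η_δ`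
  (`period_loopDifferential_symm`);
* §2 in the coordinates of a basis `w`: `ω_{∫_γ} = -(2/C) η_γ` (`omegaOf_dualCoords_periodFunctional`)
  and the **value of the Riemann form on two period vectors**,
  `E(∫_γ, ∫_δ) = -2 Re ∫_γ η_δ = 2 Re ∫_δ η_γ` (`jacobianRiemannForm_periodFunctional`) — Lange's
  «`E(λ, μ)` is integral on `H₁(C, ℤ)`» with the integer made explicit.

Everything is proved; no named facts, no instances.

## References

* H. Lange, *Abelian Varieties over the Complex Numbers*, Springer (2023), §4.1.2 Proposition 4.1.2.
  [Lange2023AbelianVarietiesComplex]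
* O. Forster, *Lectures on Riemann Surfaces*, GTM 81 (1981), §21.7. [Forster1981]
-/

noncomputable section

open scoped Manifold ContDiff Topology ComplexConjugate Real
open Set Filter Function Complex
open Literature.NumberTheory.Transcendental Literature.Analysis.Complex Literature.Topology.CoveringSpaces

namespace Literature.Geometry.Kaehler

namespace RiemannSurface

open MeromorphicOneForm ComplexTorus

universe u

variable {M : Type u} [TopologicalSpace M] [ChartedSpace ℂ M]

/-! ### §1 The loop differentials -/

section Loop

variable [ConnectedSpace M] [IsManifold 𝓘(ℂ, ℂ) ω M] [IsManifold 𝓘(ℝ, ℂ) ∞ M] [CompactSpace M]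
  [T2Space M] [Fact (Module.finrank ℝ ℂ = 2)]

omit [ConnectedSpace M] in
/-- **`ζ ↦ ⟪·, ζ⟫` is injective** (`⟪ζ, ζ⟫ ≠ 0` for `ζ ≠ 0`, Riemann's inequality).
[cite: Forster1981, §19.5] [cite: Lange2023AbelianVarietiesComplex, §4.1.2] -/
theorem pairingFunctional_injective : Injective (pairingFunctional (M := M)) := by
  intro ζ ζ' h
  by_contra hne
  have hne' : ((ζ - ζ' : ↥(holomorphicOneForms M)) : MeromorphicOneForm M) ≠ 0 := fun h0 ↦
    hne (sub_eq_zero.1 (Subtype.ext h0))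
  have h1 : pairingFunctional (ζ - ζ') = 0 := by
    rw [sub_eq_add_neg, ← neg_one_smul ℂ ζ', pairingFunctional_add, pairingFunctional_smul, map_neg, map_one,
      neg_one_smul, h, add_neg_cancel]
  have h2 : holPairing ((ζ - ζ' : ↥(holomorphicOneForms M)) : MeromorphicOneForm M)
      ((ζ - ζ' : ↥(holomorphicOneForms M)) : MeromorphicOneForm M) = 0 := by
    rw [← pairingFunctional_apply, h1, LinearMap.zero_apply]
  exact holPairing_self_ne_zero (ζ - ζ').2 hne' h2

variable (x₀ : M)

/-- **The differential of a loop**: the (unique) `η_γ ∈ Ω(M)` with `⟪θ, η_γ⟫ = -(C/2) ∫_γ θ` for all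
`θ ∈ Ω(M)`. [cite: Lange2023AbelianVarietiesComplex, §4.1.2 Proposition 4.1.2] [cite: Forster1981, §21.7] -/
def loopDifferential (γ : FundamentalGroup M x₀) : ↥(holomorphicOneForms M) :=
  Classical.choose (exists_holomorphicOneForm_holPairing_eq_period (x₀ := x₀) γ)

/-- The defining pairing identity `⟪θ, η_γ⟫ = -(C/2) ∫_γ θ`. [cite: Lange2023AbelianVarietiesComplex, §4.1.2 Proposition 4.1.2] -/
theorem holPairing_loopDifferential (γ : FundamentalGroup M x₀) (θ : ↥(holomorphicOneForms M)) :
    holPairing (θ : MeromorphicOneForm M) (loopDifferential x₀ γ : MeromorphicOneForm M) =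
      -(chartIntegralConst / 2 : ℝ) * period x₀ (θ : MeromorphicOneForm M) γ :=
  (Classical.choose_spec (exists_holomorphicOneForm_holPairing_eq_period (x₀ := x₀) γ)).1 θ

/-- **Integrality of the real periods**: `2 Re ∫_δ η_γ ∈ ℤ`. [cite: Forster1981, §21.7] -/
theorem exists_int_two_mul_re_period_loopDifferential (γ δ : FundamentalGroup M x₀) :
    ∃ n : ℤ, 2 * (period x₀ (loopDifferential x₀ γ : MeromorphicOneForm M) δ).re = n :=
  (Classical.choose_spec (exists_holomorphicOneForm_holPairing_eq_period (x₀ := x₀) γ)).2 δ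

/-- `⟪·, η_γ⟫ = -(C/2) ∫_γ` in `Ω(M)^*`. [cite: Lange2023AbelianVarietiesComplex, §4.1.2 Proposition 4.1.2] -/
theorem pairingFunctional_loopDifferential (γ : FundamentalGroup M x₀) :
    pairingFunctional (loopDifferential x₀ γ) = (-(chartIntegralConst / 2 : ℝ) : ℂ) • periodFunctional x₀ γ := by
  ext θ
  rw [pairingFunctional_apply, LinearMap.smul_apply, periodFunctional_apply, smul_eq_mul]
  exact holPairing_loopDifferential x₀ γ θ

/-- **Uniqueness**: a holomorphic differential with the pairing identity of `γ` is `η_γ`.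
[cite: Lange2023AbelianVarietiesComplex, §4.1.2 Proposition 4.1.2] -/
theorem loopDifferential_eq_of_holPairing_eq {γ : FundamentalGroup M x₀} {η : ↥(holomorphicOneForms M)}
    (h : ∀ θ : ↥(holomorphicOneForms M),
      holPairing (θ : MeromorphicOneForm M) (η : MeromorphicOneForm M) =
        -(chartIntegralConst / 2 : ℝ) * period x₀ (θ : MeromorphicOneForm M) γ) :
    η = loopDifferential x₀ γ := by
  apply pairingFunctional_injective
  ext θ
  rw [pairingFunctional_apply, pairingFunctional_apply, h θ, holPairing_loopDifferential]

/-- `η_{γδ} = η_γ + η_δ`. [cite: Lange2023AbelianVarietiesComplex, §4.1.2 Proposition 4.1.2] -/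
theorem loopDifferential_mul (γ δ : FundamentalGroup M x₀) :
    loopDifferential x₀ (γ * δ) = loopDifferential x₀ γ + loopDifferential x₀ δ := by
  symm
  refine loopDifferential_eq_of_holPairing_eq x₀ fun θ ↦ ?_
  rw [Submodule.coe_add, holPairing_add_right θ.2 (loopDifferential x₀ γ).2 (loopDifferential x₀ δ).2,
    holPairing_loopDifferential, holPairing_loopDifferential, period_mul]
  ring

/-- `η_1 = 0`. [cite: Lange2023AbelianVarietiesComplex, §4.1.2 Proposition 4.1.2] -/
theorem loopDifferential_one : loopDifferential x₀ (1 : FundamentalGroup M x₀) = 0 := by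
  symm
  refine loopDifferential_eq_of_holPairing_eq x₀ fun θ ↦ ?_
  rw [period_one, mul_zero, Submodule.coe_zero, ← zero_smul ℂ (θ : MeromorphicOneForm M),
    holPairing_smul_right _ θ.2 θ.2, map_zero, zero_mul]

/-- `η_{γ⁻¹} = -η_γ`. [cite: Lange2023AbelianVarietiesComplex, §4.1.2 Proposition 4.1.2] -/
theorem loopDifferential_inv (γ : FundamentalGroup M x₀) :
    loopDifferential x₀ γ⁻¹ = -loopDifferential x₀ γ := by
  rw [eq_neg_iff_add_eq_zero, ← loopDifferential_mul, inv_mul_cancel, loopDifferential_one]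

/-- **The loop differentials as a homomorphism** `π₁(M, x₀) → Ω(M)` (additively written).
[cite: Lange2023AbelianVarietiesComplex, §4.1.2 Proposition 4.1.2] -/
def loopDifferentialHom : Additive (FundamentalGroup M x₀) →+ ↥(holomorphicOneForms M) where
  toFun γ := loopDifferential x₀ γ.toMul
  map_zero' := loopDifferential_one x₀
  map_add' γ δ := by rw [toMul_add, loopDifferential_mul]

/-- `loopDifferentialHom x₀ γ = η_γ`. [cite: Lange2023AbelianVarietiesComplex, §4.1.2 Proposition 4.1.2] -/
@[simp] theorem loopDifferentialHom_apply (γ : FundamentalGroup M x₀) :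
    loopDifferentialHom x₀ (Additive.ofMul γ) = loopDifferential x₀ γ := rfl

/-- **Riemann's bilinear relation for the loop differentials**: `∫_δ η_γ = -conj ∫_γ η_δ`.
[cite: Forster1981, §21.7] -/
theorem period_loopDifferential_symm (γ δ : FundamentalGroup M x₀) :
    period x₀ (loopDifferential x₀ γ : MeromorphicOneForm M) δ =
      -conj (period x₀ (loopDifferential x₀ δ : MeromorphicOneForm M) γ) :=
  period_eq_neg_conj_period_of_holPairing_eq x₀ (holPairing_loopDifferential x₀ γ)
    (holPairing_loopDifferential x₀ δ)

/-- `Re ∫_δ η_γ = -Re ∫_γ η_δ`. [cite: Forster1981, §21.7] -/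
theorem re_period_loopDifferential_symm (γ δ : FundamentalGroup M x₀) :
    (period x₀ (loopDifferential x₀ γ : MeromorphicOneForm M) δ).re =
      -(period x₀ (loopDifferential x₀ δ : MeromorphicOneForm M) γ).re := by
  rw [period_loopDifferential_symm, Complex.neg_re, Complex.conj_re]

/-- `Im ∫_δ η_γ = Im ∫_γ η_δ`. [cite: Forster1981, §21.7] -/
theorem im_period_loopDifferential_symm (γ δ : FundamentalGroup M x₀) :
    (period x₀ (loopDifferential x₀ γ : MeromorphicOneForm M) δ).im =
      (period x₀ (loopDifferential x₀ δ : MeromorphicOneForm M) γ).im := by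
  rw [period_loopDifferential_symm, Complex.neg_im, Complex.conj_im, neg_neg]

/-- `⟪η_δ, η_γ⟫ = -(C/2) ∫_γ η_δ`. [cite: Lange2023AbelianVarietiesComplex, §4.1.2 Proposition 4.1.2] -/
theorem holPairing_loopDifferential_loopDifferential (γ δ : FundamentalGroup M x₀) :
    holPairing (loopDifferential x₀ δ : MeromorphicOneForm M) (loopDifferential x₀ γ : MeromorphicOneForm M) =
      -(chartIntegralConst / 2 : ℝ) * period x₀ (loopDifferential x₀ δ : MeromorphicOneForm M) γ :=
  holPairing_loopDifferential x₀ γ _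

/-- `2 Re ∫_γ η_γ ∈ ℤ` and `∫_γ η_γ` is real up to… : `Im ∫_γ η_γ` is unconstrained but `Re ∫_γ η_γ = 0`
would contradict nothing; what the relation gives on the diagonal is `∫_γ η_γ = -conj ∫_γ η_γ`, i.e.
`Re ∫_γ η_γ = 0`. [cite: Forster1981, §21.7] -/
theorem re_period_loopDifferential_self (γ : FundamentalGroup M x₀) :
    (period x₀ (loopDifferential x₀ γ : MeromorphicOneForm M) γ).re = 0 := by
  have h := re_period_loopDifferential_symm x₀ γ γ
  linarith

end Loop

/-! ### §2 The Riemann form on the period lattice -/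

section Lattice

variable [ConnectedSpace M] [IsManifold 𝓘(ℂ, ℂ) ω M] [IsManifold 𝓘(ℝ, ℂ) ∞ M] [CompactSpace M]
  [T2Space M] [Fact (Module.finrank ℝ ℂ = 2)]
  {σ : Type*} [Fintype σ] [DecidableEq σ] (w : Module.Basis σ ℂ ↥(holomorphicOneForms M)) (x₀ : M)

/-- **`ω_{∫_γ} = -(2/C) η_γ`**: the differential of the period vector of `γ` under the Riesz
isomorphism of the basis `w`. [cite: Lange2023AbelianVarietiesComplex, §4.1.2 Proposition 4.1.2] -/
theorem omegaOf_dualCoords_periodFunctional (γ : FundamentalGroup M x₀) :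
    omegaOf w (dualCoords w (periodFunctional x₀ γ)) =
      ((-(chartIntegralConst / 2))⁻¹ : ℝ) • loopDifferential x₀ γ := by
  obtain ⟨η, hω, hη, -⟩ := exists_omegaOf_dualCoords_periodFunctional w x₀ γ
  rw [hω, loopDifferential_eq_of_holPairing_eq x₀ hη]

/-- **The Riemann form on two period vectors**: `E(∫_γ, ∫_δ) = -2 Re ∫_γ η_δ`.
[cite: Lange2023AbelianVarietiesComplex, §4.1.2 Proposition 4.1.2] [cite: Forster1981, §21.7] -/
theorem jacobianRiemannForm_periodFunctional (γ δ : FundamentalGroup M x₀) :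
    jacobianRiemannForm w ![dualCoords w (periodFunctional x₀ γ), dualCoords w (periodFunctional x₀ δ)] =
      -(2 * (period x₀ (loopDifferential x₀ δ : MeromorphicOneForm M) γ).re) := by
  set k : ℝ := -(chartIntegralConst / 2) with hk
  have hk0 : k ≠ 0 := by
    rw [hk]; exact neg_ne_zero.2 (div_ne_zero chartIntegralConst_pos.ne' two_ne_zero)
  have h1 : ((((k⁻¹ : ℝ) : ℂ) • (loopDifferential x₀ γ : MeromorphicOneForm M))).IsHolomorphic :=
    (((k⁻¹ : ℝ) : ℂ) • loopDifferential x₀ γ).2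
  rw [jacobianRiemannForm_apply, omegaOf_dualCoords_periodFunctional, omegaOf_dualCoords_periodFunctional,
    ← Complex.coe_smul, ← Complex.coe_smul, Submodule.coe_smul, Submodule.coe_smul,
    holPairing_smul_left _ (loopDifferential x₀ δ).2 h1,
    holPairing_smul_right _ (loopDifferential x₀ δ).2 (loopDifferential x₀ γ).2, Complex.conj_ofReal,
    holPairing_loopDifferential_loopDifferential]
  rw [show ((k⁻¹ : ℝ) : ℂ) * (((k⁻¹ : ℝ) : ℂ) * (-((chartIntegralConst / 2 : ℝ) : ℂ) *
      period x₀ (loopDifferential x₀ δ : MeromorphicOneForm M) γ)) =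
      ((k⁻¹ * (k⁻¹ * k) : ℝ) : ℂ) * period x₀ (loopDifferential x₀ δ : MeromorphicOneForm M) γ by
      rw [hk]; push_cast; ring,
    inv_mul_cancel₀ hk0, mul_one, Complex.re_ofReal_mul, hk]
  have hC : chartIntegralConst ≠ 0 := chartIntegralConst_pos.ne'
  field_simp

/-- The same with the relation applied: `E(∫_γ, ∫_δ) = 2 Re ∫_δ η_γ`. [cite: Forster1981, §21.7] -/
theorem jacobianRiemannForm_periodFunctional' (γ δ : FundamentalGroup M x₀) :
    jacobianRiemannForm w ![dualCoords w (periodFunctional x₀ γ), dualCoords w (periodFunctional x₀ δ)] =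
      2 * (period x₀ (loopDifferential x₀ γ : MeromorphicOneForm M) δ).re := by
  rw [jacobianRiemannForm_periodFunctional, re_period_loopDifferential_symm]
  ring

/-- **Integrality, explicit**: `E(∫_γ, ∫_δ)` is the integer `2 Re ∫_δ η_γ`.
[cite: Lange2023AbelianVarietiesComplex, §4.1.2 Proposition 4.1.2] -/
theorem exists_int_jacobianRiemannForm_periodFunctional (γ δ : FundamentalGroup M x₀) :
    ∃ n : ℤ, jacobianRiemannForm w ![dualCoords w (periodFunctional x₀ γ), dualCoords w (periodFunctional x₀ δ)] = n := by
  obtain ⟨n, hn⟩ := exists_int_two_mul_re_period_loopDifferential x₀ γ δ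
  exact ⟨n, by rw [jacobianRiemannForm_periodFunctional', hn]⟩

/-- `E(∫_γ, ∫_γ) = 0` on the diagonal (consistent with alternation). [cite: Forster1981, §21.7] -/
theorem jacobianRiemannForm_periodFunctional_self (γ : FundamentalGroup M x₀) :
    jacobianRiemannForm w ![dualCoords w (periodFunctional x₀ γ), dualCoords w (periodFunctional x₀ γ)] = 0 := by
  rw [jacobianRiemannForm_periodFunctional', re_period_loopDifferential_self, mul_zero]

end Lattice

end RiemannSurface

end Literature.Geometry.Kaehler

end
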